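import Literature.Analysis.FluidPDE.WholeSpaceIBP
import Literature.Analysis.FluidPDE.DecayingSelfSimilarEulerProfile
import Literature.Analysis.FluidPDE.PoincareHomotopyOperatorL2
import HarnessLib

/-!
# A smooth force does work on a localized divergence-free eddy only through its curl
# (the coupling estimate behind «seed, never driver», MEMO-2 §2)

Cell `ns-blowup`, seat `ns-blowup-ecbridge-2` (g3; E–C endpoint theory seat). LABEL: E–C typing
(KERNEL; exact vector calculus). WHAT THIS IS NOT: not Navier–Stokes evidence — an identity and an
inequality for the pairing `∫ ⟪f, w⟫` of an arbitrary `C¹`/`C²` field `f` (the force) with a compactly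
supported divergence-free field `w` (the eddy); no flow, tower or profile is involved. Companion memo
`run/shared/lean/pub/ns-blowup/ecbridge2/ECBRIDGE-2-MEMO-2.md` §2.

## Content (physical space `ℝ³ = EuclideanSpace ℝ (Fin 3)`)

For `w ∈ C¹_c(ℝ³; ℝ³)` with `div w = 0`:

* §1 `integral_fderiv_apply_eq_zero_of_divFree` — `∫ Dθ(x)[w(x)] dx = 0` for every `θ ∈ C¹(ℝ³; ℝ)`
  (the tree's `integral_mul_divergence_add_eq_zero_right`, Leray 1934 §6 (1.11), with `div w = 0`);
  hence `integral_inner_const_eq_zero_of_divFree` — `∫ ⟪c, w⟫ = 0` (zero linear impulse, `θ = ⟪c, ·⟫`)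
  and `integral_inner_clm_apply_add_eq_zero_of_divFree` — `∫ (⟪L(x−x₀), w⟫ + ⟪L w, x−x₀⟫) = 0` for
  every continuous linear `L` (`θ = ⟪L(x−x₀), x−x₀⟫`): the SYMMETRIC part of a linear field does no
  work on `w`.
* §2 `integral_inner_fderiv_apply_eq_half_curl` — with `L = Df(x₀)` the antisymmetric part is the curl
  (tree `inner_cross_curl_left`): `∫ ⟪Df(x₀)(x−x₀), w(x)⟫ = ½ ∫ ⟪curl f(x₀) × (x−x₀), w(x)⟫`; and the
  DECOMPOSITION `integral_inner_eq_taylorRemainder_add_half_curl`: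
  `∫ ⟪f, w⟫ = ∫ ⟪f(x) − f(x₀) − Df(x₀)(x−x₀), w(x)⟫ + ½ ∫ ⟪curl f(x₀) × (x−x₀), w(x)⟫`.
* §3 `abs_integral_inner_le_of_divFree` — if `tsupport w ⊆ B̄(x₀, r)` and the first-order Taylor
  remainder of `f` at `x₀` is `≤ ρ` on that ball, then `|∫ ⟪f, w⟫| ≤ (ρ + ½‖curl f(x₀)‖ r) ∫‖w‖`; and
  `abs_integral_inner_le_of_contDiff_two` — for `f ∈ C²` with `‖D²f‖ ≤ M₂` on the ball, `ρ = M₂ r²`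
  (mean value inequality twice): **`|∫ ⟪f, w⟫| ≤ (M₂ r² + ½‖curl f(x₀)‖ r) · ∫‖w‖`**.

READING (memo §2): the power a Clay-class force injects into a divergence-free eddy of size `r`
carrying `∫‖w‖ ≍ W r³` is `≲ (‖curl f‖_∞ r + ‖D²f‖_∞ r²) W r³`, against a kinetic energy `≍ W² r³`:
relative rate `≲ ‖curl f‖_∞ r / W` — at tower level `k` (`r = N_k⁻¹`, `W = Y_k = N_k^{β−1}`) this is
`≲ ‖curl f‖_∞ N_k^{−β}`; the gradient part of `f` never enters (it is pressure), uniformly constant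
forces never enter (Galilean), and pure strains never enter (symmetric part) — only vorticity injection
`curl f` at first order and curvature `D²f` at second order.

References: J. Leray, Acta Math. 63 (1934) §6 (1.11) (integration by parts without boundary)
[cite: Leray1934, §6 (1.11)]; A. J. Majda, A. L. Bertozzi, *Vorticity and Incompressible Flow* (CUP 2002)
§1.4 (1.19)–(1.21) (`D v = S + Ω`, `Ω h = ½ ω × h`), §1.7 (linear/angular impulse of compactly
supported vorticity) [cite: MajdaBertozziCUP2002, §1.4 and §1.7].
-/

noncomputable section

namespace Summit.NavierStokesRegularity.FluidComputer.ForceEddyCoupling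

open MeasureTheory Set Function Filter Topology InnerProductSpace Metric
open scoped RealInnerProductSpace
open Literature.Analysis.FluidPDE

variable {w : (EuclideanSpace ℝ (Fin 3)) → (EuclideanSpace ℝ (Fin 3))}

/-! ## §0 Integrability of pairings against a compactly supported eddy -/

/-- A continuous pairing `x ↦ ⟪g x, w x⟫` against a continuous compactly supported `w` is integrable.
[folklore] -/
theorem integrable_inner_of_hasCompactSupport {g : (EuclideanSpace ℝ (Fin 3)) → (EuclideanSpace ℝ (Fin 3))} (hg : Continuous g) (hw : Continuous w)
    (hc : HasCompactSupport w) : Integrable (fun x => ⟪g x, w x⟫) := by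
  refine (hg.inner hw).integrable_of_hasCompactSupport (hc.mono fun x hx => ?_)
  contrapose! hx
  simp only [mem_support, not_not] at hx
  simp [hx]

/-- A continuous pairing `x ↦ ⟪L (w x), g x⟫` (the eddy fed through a continuous linear map)
against a continuous `g` is integrable when `w` has compact support. [folklore] -/
theorem integrable_inner_clm_of_hasCompactSupport (L : (EuclideanSpace ℝ (Fin 3)) →L[ℝ] (EuclideanSpace ℝ (Fin 3))) {g : (EuclideanSpace ℝ (Fin 3)) → (EuclideanSpace ℝ (Fin 3))} (hg : Continuous g)
    (hw : Continuous w) (hc : HasCompactSupport w) : Integrable (fun x => ⟪L (w x), g x⟫) := by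
  refine ((L.continuous.comp hw).inner hg).integrable_of_hasCompactSupport (hc.mono fun x hx => ?_)
  contrapose! hx
  simp only [mem_support, not_not] at hx
  simp [hx]

/-! ## §1 Divergence-free eddies annihilate gradients: linear impulse and symmetric strains -/

/-- **`∫ Dθ[w] = 0` for `θ ∈ C¹` and a divergence-free `w ∈ C¹_c`** (Leray's integration by parts
`∫ θ div w + ∫ ⟪w, ∇θ⟫ = 0` with `div w = 0`, and `⟪w, ∇θ⟫ = Dθ[w]`). [cite: Leray1934, §6 (1.11)] -/
theorem integral_fderiv_apply_eq_zero_of_divFree {θ : (EuclideanSpace ℝ (Fin 3)) → ℝ} (hθ : ContDiff ℝ 1 θ)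
    (hw : ContDiff ℝ 1 w) (hc : HasCompactSupport w)
    (hdiv : ∀ x, VectorCalculus.divergence w x = 0) :
    ∫ x, fderiv ℝ θ x (w x) = 0 := by
  have h := integral_mul_divergence_add_eq_zero_right hθ hw hc
  have h0 : (∫ x, θ x * VectorCalculus.divergence w x) = 0 := by
    simp [hdiv]
  rw [h0, zero_add] at h
  rw [← h]
  refine integral_congr_ae (Eventually.of_forall fun x => ?_)
  simp [inner_gradient_right]

/-- **Zero linear impulse: `∫ ⟪c, w⟫ = 0`** for a constant `c` and a divergence-free `w ∈ C¹_c`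
(`θ = ⟪c, ·⟫`; Majda–Bertozzi §1.7). A uniform force does no net work on an eddy.
[cite: MajdaBertozziCUP2002, §1.7] -/
theorem integral_inner_const_eq_zero_of_divFree (c : (EuclideanSpace ℝ (Fin 3))) (hw : ContDiff ℝ 1 w)
    (hc : HasCompactSupport w) (hdiv : ∀ x, VectorCalculus.divergence w x = 0) :
    ∫ x, ⟪c, w x⟫ = 0 := by
  have hθ : ContDiff ℝ 1 (fun y : (EuclideanSpace ℝ (Fin 3)) => ⟪c, y⟫) := contDiff_const.inner ℝ contDiff_id
  have h := integral_fderiv_apply_eq_zero_of_divFree hθ hw hc hdiv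
  rw [← h]
  refine integral_congr_ae (Eventually.of_forall fun x => ?_)
  have hd : HasFDerivAt (fun y : (EuclideanSpace ℝ (Fin 3)) => ⟪c, y⟫)
      ((fderivInnerCLM ℝ (c, x)).comp ((0 : (EuclideanSpace ℝ (Fin 3)) →L[ℝ] (EuclideanSpace ℝ (Fin 3))).prod (ContinuousLinearMap.id ℝ (EuclideanSpace ℝ (Fin 3))))) x :=
    (hasFDerivAt_const c x).inner ℝ (hasFDerivAt_id x)
  show ⟪c, w x⟫ = fderiv ℝ (fun y : (EuclideanSpace ℝ (Fin 3)) => ⟪c, y⟫) x (w x)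
  rw [hd.fderiv]
  simp [fderivInnerCLM_apply]

/-- **Symmetric strains do no work: `∫ (⟪L(x−x₀), w(x)⟫ + ⟪L(w(x)), x−x₀⟫) dx = 0`** for every
continuous linear `L` and divergence-free `w ∈ C¹_c` (`θ(x) = ⟪L(x−x₀), x−x₀⟫`, whose derivative is
`v ↦ ⟪L v, x−x₀⟫ + ⟪L(x−x₀), v⟫`). [cite: MajdaBertozziCUP2002, §1.4 (1.19)–(1.21)] -/
theorem integral_inner_clm_apply_add_eq_zero_of_divFree (L : (EuclideanSpace ℝ (Fin 3)) →L[ℝ] (EuclideanSpace ℝ (Fin 3))) (x₀ : (EuclideanSpace ℝ (Fin 3)))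
    (hw : ContDiff ℝ 1 w) (hc : HasCompactSupport w)
    (hdiv : ∀ x, VectorCalculus.divergence w x = 0) :
    ∫ x, (⟪L (x - x₀), w x⟫ + ⟪L (w x), x - x₀⟫) = 0 := by
  -- the quadratic form `θ(x) = ⟪L(x - x₀), x - x₀⟫` and its derivative
  set θ : (EuclideanSpace ℝ (Fin 3)) → ℝ := fun x => ⟪L (x - x₀), x - x₀⟫ with hθdef
  have hsub : ∀ x : (EuclideanSpace ℝ (Fin 3)), HasFDerivAt (fun y : (EuclideanSpace ℝ (Fin 3)) => y - x₀) (ContinuousLinearMap.id ℝ (EuclideanSpace ℝ (Fin 3))) x :=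
    fun x => (hasFDerivAt_id x).sub_const x₀
  have hL : ∀ x : (EuclideanSpace ℝ (Fin 3)), HasFDerivAt (fun y : (EuclideanSpace ℝ (Fin 3)) => L (y - x₀)) (L.comp (ContinuousLinearMap.id ℝ (EuclideanSpace ℝ (Fin 3)))) x :=
    fun x => L.hasFDerivAt.comp x (hsub x)
  have hθ' : ∀ x : (EuclideanSpace ℝ (Fin 3)), HasFDerivAt θ
      ((fderivInnerCLM ℝ (L (x - x₀), x - x₀)).comp
        ((L.comp (ContinuousLinearMap.id ℝ (EuclideanSpace ℝ (Fin 3)))).prod (ContinuousLinearMap.id ℝ (EuclideanSpace ℝ (Fin 3))))) x :=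
    fun x => (hL x).inner ℝ (hsub x)
  have hθ : ContDiff ℝ 1 θ :=
    (L.contDiff.comp (contDiff_id.sub contDiff_const)).inner ℝ (contDiff_id.sub contDiff_const)
  have h := integral_fderiv_apply_eq_zero_of_divFree hθ hw hc hdiv
  rw [← h]
  refine integral_congr_ae (Eventually.of_forall fun x => ?_)
  show ⟪L (x - x₀), w x⟫ + ⟪L (w x), x - x₀⟫ = fderiv ℝ θ x (w x)
  rw [(hθ' x).fderiv]
  simp [fderivInnerCLM_apply]

/-! ## §2 The antisymmetric part is the curl -/

/-- **The antisymmetric part of `Df(x₀)` pairs through the curl**: for divergence-free `w ∈ C¹_c`,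
`∫ ⟪Df(x₀)(x−x₀), w(x)⟫ = ½ ∫ ⟪curl f(x₀) × (x−x₀), w(x)⟫` (split `⟪L a, b⟫` into its symmetric
half, which integrates to zero by `integral_inner_clm_apply_add_eq_zero_of_divFree`, and its
antisymmetric half `½(⟪b, L a⟫ − ⟪a, L b⟫) = ½⟪curl f(x₀) × a, b⟫`, tree `inner_cross_curl_left`).
[cite: MajdaBertozziCUP2002, §1.4 (1.19)–(1.21)] -/
theorem integral_inner_fderiv_apply_eq_half_curl (f : (EuclideanSpace ℝ (Fin 3)) → (EuclideanSpace ℝ (Fin 3))) (x₀ : (EuclideanSpace ℝ (Fin 3))) (hw : ContDiff ℝ 1 w)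
    (hc : HasCompactSupport w) (hdiv : ∀ x, VectorCalculus.divergence w x = 0) :
    ∫ x, ⟪fderiv ℝ f x₀ (x - x₀), w x⟫ =
      (1 / 2 : ℝ) * ∫ x, ⟪cross (curl f x₀) (x - x₀), w x⟫ := by
  set L : (EuclideanSpace ℝ (Fin 3)) →L[ℝ] (EuclideanSpace ℝ (Fin 3)) := fderiv ℝ f x₀ with hLdef
  have hwc : Continuous w := hw.continuous
  have hsubc : Continuous (fun x : (EuclideanSpace ℝ (Fin 3)) => x - x₀) := continuous_id.sub continuous_const
  -- integrability of the three pairings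
  have hI1 : Integrable (fun x => ⟪L (x - x₀), w x⟫) :=
    integrable_inner_of_hasCompactSupport (L.continuous.comp hsubc) hwc hc
  have hI2 : Integrable (fun x => ⟪L (w x), x - x₀⟫) :=
    integrable_inner_clm_of_hasCompactSupport L hsubc hwc hc
  have hI3 : Integrable (fun x => ⟪cross (curl f x₀) (x - x₀), w x⟫) := by
    refine integrable_inner_of_hasCompactSupport ?_ hwc hc
    -- `a ↦ cross c a` is (the coercion of) a linear map, hence continuous
    have hlin : Continuous (fun a : (EuclideanSpace ℝ (Fin 3)) => cross (curl f x₀) a) := by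
      have : (fun a : (EuclideanSpace ℝ (Fin 3)) => cross (curl f x₀) a) =
          fun a => WithLp.toLp 2 (crossProduct (WithLp.ofLp (curl f x₀)) (WithLp.ofLp a)) := rfl
      rw [this]
      exact (PiLp.continuous_toLp 2 _).comp
        ((LinearMap.continuous_of_finiteDimensional _).comp (PiLp.continuous_ofLp 2 _))
    exact hlin.comp hsubc
  -- pointwise splitting into symmetric and antisymmetric halves
  have hpt : ∀ x, ⟪L (x - x₀), w x⟫ =
      (1 / 2 : ℝ) * (⟪L (x - x₀), w x⟫ + ⟪L (w x), x - x₀⟫) +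
        (1 / 2 : ℝ) * ⟪cross (curl f x₀) (x - x₀), w x⟫ := by
    intro x
    rw [inner_cross_curl_left f x₀ (x - x₀) (w x), ← hLdef, real_inner_comm (L (x - x₀)) (w x),
      real_inner_comm (L (w x)) (x - x₀)]
    ring
  have hsym := integral_inner_clm_apply_add_eq_zero_of_divFree L x₀ hw hc hdiv
  have hIS : Integrable (fun x => (1 / 2 : ℝ) * (⟪L (x - x₀), w x⟫ + ⟪L (w x), x - x₀⟫)) :=
    (hI1.add hI2).const_mul _
  have hIC : Integrable (fun x => (1 / 2 : ℝ) * ⟪cross (curl f x₀) (x - x₀), w x⟫) :=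
    hI3.const_mul _
  have hstep : ∫ x, ⟪L (x - x₀), w x⟫ =
      ((1 / 2 : ℝ) * ∫ x, (⟪L (x - x₀), w x⟫ + ⟪L (w x), x - x₀⟫)) +
        (1 / 2 : ℝ) * ∫ x, ⟪cross (curl f x₀) (x - x₀), w x⟫ := by
    rw [integral_congr_ae (Eventually.of_forall hpt), integral_add hIS hIC, integral_const_mul,
      integral_const_mul]
  rw [hstep, hsym, mul_zero, zero_add]

/-- **DECOMPOSITION of the work of a force on a divergence-free eddy**: for `f` continuous and
`w ∈ C¹_c` divergence free,
`∫ ⟪f, w⟫ = ∫ ⟪f(x) − f(x₀) − Df(x₀)(x−x₀), w(x)⟫ + ½ ∫ ⟪curl f(x₀) × (x−x₀), w(x)⟫`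
(the constant `f(x₀)` drops by `integral_inner_const_eq_zero_of_divFree`, the symmetric part of
`Df(x₀)` by `integral_inner_fderiv_apply_eq_half_curl`). Only vorticity injection at first order and
the Taylor remainder survive. [cite: MajdaBertozziCUP2002, §1.4 and §1.7] -/
theorem integral_inner_eq_taylorRemainder_add_half_curl {f : (EuclideanSpace ℝ (Fin 3)) → (EuclideanSpace ℝ (Fin 3))} (hf : Continuous f) (x₀ : (EuclideanSpace ℝ (Fin 3)))
    (hw : ContDiff ℝ 1 w) (hc : HasCompactSupport w)
    (hdiv : ∀ x, VectorCalculus.divergence w x = 0) :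
    ∫ x, ⟪f x, w x⟫ =
      (∫ x, ⟪f x - f x₀ - fderiv ℝ f x₀ (x - x₀), w x⟫) +
        (1 / 2 : ℝ) * ∫ x, ⟪cross (curl f x₀) (x - x₀), w x⟫ := by
  set L : (EuclideanSpace ℝ (Fin 3)) →L[ℝ] (EuclideanSpace ℝ (Fin 3)) := fderiv ℝ f x₀ with hLdef
  have hwc : Continuous w := hw.continuous
  have hsubc : Continuous (fun x : (EuclideanSpace ℝ (Fin 3)) => x - x₀) := continuous_id.sub continuous_const
  have hRc : Continuous (fun x => f x - f x₀ - L (x - x₀)) :=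
    (hf.sub continuous_const).sub (L.continuous.comp hsubc)
  have hIR : Integrable (fun x => ⟪f x - f x₀ - L (x - x₀), w x⟫) :=
    integrable_inner_of_hasCompactSupport hRc hwc hc
  have hIc : Integrable (fun x => ⟪f x₀, w x⟫) :=
    integrable_inner_of_hasCompactSupport continuous_const hwc hc
  have hIL : Integrable (fun x => ⟪L (x - x₀), w x⟫) :=
    integrable_inner_of_hasCompactSupport (L.continuous.comp hsubc) hwc hc
  have hpt : ∀ x, ⟪f x, w x⟫ =
      ⟪f x - f x₀ - L (x - x₀), w x⟫ + ⟪f x₀, w x⟫ + ⟪L (x - x₀), w x⟫ := by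
    intro x
    rw [← inner_add_left, ← inner_add_left]
    congr 1
    abel
  have hIRc : Integrable (fun x => ⟪f x - f x₀ - L (x - x₀), w x⟫ + ⟪f x₀, w x⟫) := hIR.add hIc
  rw [integral_congr_ae (Eventually.of_forall hpt), integral_add hIRc hIL,
    integral_add hIR hIc, integral_inner_const_eq_zero_of_divFree (f x₀) hw hc hdiv, add_zero,
    hLdef, integral_inner_fderiv_apply_eq_half_curl f x₀ hw hc hdiv]

/-! ## §3 The estimate: only `curl f` (order `r`) and `D²f` (order `r²`) couple -/

/-- **WORK ESTIMATE, abstract remainder.** Let `w ∈ C¹_c` be divergence free with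
`tsupport w ⊆ B̄(x₀, r)`, `f` continuous with first-order Taylor remainder
`‖f(x) − f(x₀) − Df(x₀)(x−x₀)‖ ≤ ρ` on `B̄(x₀, r)`. Then
`|∫ ⟪f, w⟫| ≤ (ρ + ½ ‖curl f(x₀)‖ r) · ∫ ‖w‖`. [cite: MajdaBertozziCUP2002, §1.4 and §1.7] -/
theorem abs_integral_inner_le_of_divFree {f : (EuclideanSpace ℝ (Fin 3)) → (EuclideanSpace ℝ (Fin 3))} (hf : Continuous f) {x₀ : (EuclideanSpace ℝ (Fin 3))} {r ρ : ℝ}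
    (hw : ContDiff ℝ 1 w) (hc : HasCompactSupport w)
    (hdiv : ∀ x, VectorCalculus.divergence w x = 0) (hsupp : tsupport w ⊆ closedBall x₀ r)
    (hrem : ∀ x ∈ closedBall x₀ r, ‖f x - f x₀ - fderiv ℝ f x₀ (x - x₀)‖ ≤ ρ) :
    |∫ x, ⟪f x, w x⟫| ≤ (ρ + 1 / 2 * ‖curl f x₀‖ * r) * ∫ x, ‖w x‖ := by
  rw [integral_inner_eq_taylorRemainder_add_half_curl hf x₀ hw hc hdiv]
  have hwc : Continuous w := hw.continuous
  have hIn : Integrable (fun x => ‖w x‖) := (hwc.norm).integrable_of_hasCompactSupport hc.norm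
  -- where `w x ≠ 0`, the point lies in the ball
  have hball : ∀ x, w x ≠ 0 → x ∈ closedBall x₀ r := fun x hx =>
    hsupp (subset_tsupport _ (mem_support.mpr hx))
  -- first piece: the Taylor remainder
  have h1 : |∫ x, ⟪f x - f x₀ - fderiv ℝ f x₀ (x - x₀), w x⟫| ≤ ρ * ∫ x, ‖w x‖ := by
    rw [← integral_const_mul, ← Real.norm_eq_abs]
    refine norm_integral_le_of_norm_le (hIn.const_mul ρ) (Eventually.of_forall fun x => ?_)
    by_cases hx : w x = 0
    · simp [hx]
    · rw [Real.norm_eq_abs]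
      calc |⟪f x - f x₀ - fderiv ℝ f x₀ (x - x₀), w x⟫|
          ≤ ‖f x - f x₀ - fderiv ℝ f x₀ (x - x₀)‖ * ‖w x‖ := abs_real_inner_le_norm _ _
        _ ≤ ρ * ‖w x‖ := mul_le_mul_of_nonneg_right (hrem x (hball x hx)) (norm_nonneg _)
  -- second piece: vorticity injection
  have h2 : |∫ x, ⟪cross (curl f x₀) (x - x₀), w x⟫| ≤ (‖curl f x₀‖ * r) * ∫ x, ‖w x‖ := by
    rw [← integral_const_mul, ← Real.norm_eq_abs]
    refine norm_integral_le_of_norm_le (hIn.const_mul _) (Eventually.of_forall fun x => ?_)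
    by_cases hx : w x = 0
    · simp [hx]
    · rw [Real.norm_eq_abs]
      have hxr : ‖x - x₀‖ ≤ r := by
        have := hball x hx
        rwa [mem_closedBall, dist_eq_norm] at this
      calc |⟪cross (curl f x₀) (x - x₀), w x⟫|
          ≤ ‖cross (curl f x₀) (x - x₀)‖ * ‖w x‖ := abs_real_inner_le_norm _ _
        _ ≤ (‖curl f x₀‖ * ‖x - x₀‖) * ‖w x‖ :=
            mul_le_mul_of_nonneg_right (norm_cross_le _ _) (norm_nonneg _)
        _ ≤ (‖curl f x₀‖ * r) * ‖w x‖ := by gcongr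
  have hInn : 0 ≤ ∫ x, ‖w x‖ := integral_nonneg fun x => norm_nonneg _
  calc |(∫ x, ⟪f x - f x₀ - fderiv ℝ f x₀ (x - x₀), w x⟫) +
          1 / 2 * ∫ x, ⟪cross (curl f x₀) (x - x₀), w x⟫|
      ≤ |∫ x, ⟪f x - f x₀ - fderiv ℝ f x₀ (x - x₀), w x⟫| +
          |1 / 2 * ∫ x, ⟪cross (curl f x₀) (x - x₀), w x⟫| := abs_add_le _ _
    _ = |∫ x, ⟪f x - f x₀ - fderiv ℝ f x₀ (x - x₀), w x⟫| +
          1 / 2 * |∫ x, ⟪cross (curl f x₀) (x - x₀), w x⟫| := by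
        rw [abs_mul, abs_of_pos (by norm_num : (0 : ℝ) < 1 / 2)]
    _ ≤ (ρ * ∫ x, ‖w x‖) + 1 / 2 * ((‖curl f x₀‖ * r) * ∫ x, ‖w x‖) :=
        add_le_add h1 (mul_le_mul_of_nonneg_left h2 (by norm_num))
    _ = (ρ + 1 / 2 * ‖curl f x₀‖ * r) * ∫ x, ‖w x‖ := by ring

/-- **Second-order Taylor remainder on a ball** (mean value inequality twice): if `f ∈ C²` and
`‖D²f(x)‖ ≤ M₂` on `B̄(x₀, r)`, then `‖f(x) − f(x₀) − Df(x₀)(x−x₀)‖ ≤ M₂ r²` there. [folklore] -/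
theorem norm_taylorRemainder_le_of_contDiff_two {f : (EuclideanSpace ℝ (Fin 3)) → (EuclideanSpace ℝ (Fin 3))} (hf : ContDiff ℝ 2 f) {x₀ : (EuclideanSpace ℝ (Fin 3))}
    {r M₂ : ℝ} (hM₂ : ∀ x ∈ closedBall x₀ r, ‖fderiv ℝ (fderiv ℝ f) x‖ ≤ M₂)
    {x : (EuclideanSpace ℝ (Fin 3))} (hx : x ∈ closedBall x₀ r) :
    ‖f x - f x₀ - fderiv ℝ f x₀ (x - x₀)‖ ≤ M₂ * r ^ 2 := by
  have hconv : Convex ℝ (closedBall x₀ r) := convex_closedBall x₀ r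
  have hx₀ : x₀ ∈ closedBall x₀ r := by
    have : 0 ≤ r := le_trans dist_nonneg (mem_closedBall.mp hx)
    exact mem_closedBall_self this
  have hr : ‖x - x₀‖ ≤ r := by rwa [mem_closedBall, dist_eq_norm] at hx
  have hr0 : 0 ≤ r := le_trans (norm_nonneg _) hr
  -- `Df` is `M₂ r`-close to `Df(x₀)` on the ball
  have hDf : Differentiable ℝ (fderiv ℝ f) :=
    (hf.fderiv_right (m := 1) (by norm_num)).differentiable one_ne_zero
  have hD1 : ∀ y ∈ closedBall x₀ r, ‖fderiv ℝ f y - fderiv ℝ f x₀‖ ≤ M₂ * r := by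
    intro y hy
    have h := hconv.norm_image_sub_le_of_norm_fderiv_le (fun z _ => hDf z) hM₂ hx₀ hy
    have hyr : ‖y - x₀‖ ≤ r := by rwa [mem_closedBall, dist_eq_norm] at hy
    have hM0 : 0 ≤ M₂ := (norm_nonneg (fderiv ℝ (fderiv ℝ f) x₀)).trans (hM₂ x₀ hx₀)
    exact h.trans (mul_le_mul_of_nonneg_left hyr hM0)
  -- apply the mean value inequality to `g(y) = f(y) − Df(x₀)(y − x₀)`
  set L : (EuclideanSpace ℝ (Fin 3)) →L[ℝ] (EuclideanSpace ℝ (Fin 3)) := fderiv ℝ f x₀ with hLdef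
  set g : (EuclideanSpace ℝ (Fin 3)) → (EuclideanSpace ℝ (Fin 3)) := fun y => f y - L (y - x₀) with hgdef
  have hfd : Differentiable ℝ f := hf.differentiable two_ne_zero
  have hgd : ∀ y, HasFDerivAt g (fderiv ℝ f y - L) y := by
    intro y
    have h1 : HasFDerivAt f (fderiv ℝ f y) y := (hfd y).hasFDerivAt
    have h2 : HasFDerivAt (fun z : (EuclideanSpace ℝ (Fin 3)) => L (z - x₀)) (L.comp (ContinuousLinearMap.id ℝ (EuclideanSpace ℝ (Fin 3)))) y :=
      L.hasFDerivAt.comp y ((hasFDerivAt_id y).sub_const x₀)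
    have h12 := h1.sub h2
    rw [ContinuousLinearMap.comp_id] at h12
    exact h12
  have hgbound : ∀ y ∈ closedBall x₀ r, ‖fderiv ℝ g y‖ ≤ M₂ * r := by
    intro y hy
    rw [(hgd y).fderiv]
    exact hD1 y hy
  have h := hconv.norm_image_sub_le_of_norm_fderiv_le (fun y _ => (hgd y).differentiableAt)
    hgbound hx₀ hx
  have hgx : g x - g x₀ = f x - f x₀ - L (x - x₀) := by
    simp only [hgdef, sub_self, map_zero, sub_zero]
    abel
  rw [← hgx]
  calc ‖g x - g x₀‖ ≤ M₂ * r * ‖x - x₀‖ := h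
    _ ≤ M₂ * r * r := by
        have hM0 : 0 ≤ M₂ * r :=
          mul_nonneg ((norm_nonneg (fderiv ℝ (fderiv ℝ f) x₀)).trans (hM₂ x₀ hx₀)) hr0
        exact mul_le_mul_of_nonneg_left hr hM0
    _ = M₂ * r ^ 2 := by ring

/-- **WORK ESTIMATE for a `C²` force**: `w ∈ C¹_c` divergence free with `tsupport w ⊆ B̄(x₀, r)`,
`f ∈ C²` with `‖D²f‖ ≤ M₂` on `B̄(x₀, r)`. Then
`|∫ ⟪f, w⟫| ≤ (M₂ r² + ½ ‖curl f(x₀)‖ r) · ∫ ‖w‖` — a smooth force couples to a small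
divergence-free eddy only through its curl (order `r`) and its second derivative (order `r²`).
[cite: MajdaBertozziCUP2002, §1.4 and §1.7] -/
theorem abs_integral_inner_le_of_contDiff_two {f : (EuclideanSpace ℝ (Fin 3)) → (EuclideanSpace ℝ (Fin 3))} (hf : ContDiff ℝ 2 f) {x₀ : (EuclideanSpace ℝ (Fin 3))}
    {r M₂ : ℝ} (hM₂ : ∀ x ∈ closedBall x₀ r, ‖fderiv ℝ (fderiv ℝ f) x‖ ≤ M₂)
    (hw : ContDiff ℝ 1 w) (hc : HasCompactSupport w)
    (hdiv : ∀ x, VectorCalculus.divergence w x = 0) (hsupp : tsupport w ⊆ closedBall x₀ r) :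
    |∫ x, ⟪f x, w x⟫| ≤ (M₂ * r ^ 2 + 1 / 2 * ‖curl f x₀‖ * r) * ∫ x, ‖w x‖ :=
  abs_integral_inner_le_of_divFree hf.continuous hw hc hdiv hsupp
    (fun _ hx => norm_taylorRemainder_le_of_contDiff_two hf hM₂ hx)

end Summit.NavierStokesRegularity.FluidComputer.ForceEddyCoupling

end
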